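import Literature.AlgebraicGeometry.HodgeTheory.CanonicalDegreeHypersurfaceResidueForm
import Mathlib.RingTheory.Nullstellensatz
import HarnessLib

/-!
# The residue forms `Res(PΩ/F)` of a hypersurface of any degree `d ≥ m + 2`: linearity in the
# numerator, the transformation `Φ^* Res(PΩ/F) = det(a) · Res(P(a • x) Ω/F)` under diagonal
# symmetries, and the vanishing criterion `Res(PΩ/F) = 0 ↔ F ∣ P`

Family `hodge`, layer `Literature/AlgebraicGeometry/HodgeTheory`. PROOF FILE (theorems only; no
definition, no named fact — D-0026), in the setting of `HypersurfaceResidueFormDef` /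
`ProjectiveModelDiagonalSymmetry` / `CanonicalDegreeHypersurfaceResidueForm`: `F ∈ ℂ[X₀, …, X_{m+1}]`
homogeneous of degree `d` with non-vanishing gradient on its cone, `M` a complex manifold charted on
`E` (`dim_ℂ E = m`) with a topological embedding `ψ : M → ℙ(ℂ^{m+2})` into `V(F)` whose affine
coordinates are holomorphic, and a holomorphic self-map `Φ` lying over the diagonal symmetry
`[z] ↦ [a • z]`, `F(a • z) = F(z)`. The companion file `CanonicalDegreeHypersurfaceResidueForm` treats
the numerator `P = 1` in the canonical degree `d = m + 2`; this file treats a GENERAL homogeneous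
numerator `P` of degree `d − m − 2 ≥ 0` (Griffiths' residues `Res_Y(PΩ/F)` at pole order one,
Voisin II §6.1.3, Cor. 6.12 at `p = 1`: `S^{d−m−2} ↪ H^{m,0}(Y)`):

* `residueForm_add`, `residueForm_smul`, `residueForm_zero` — the residue form is `ℂ`-linear in the
  numerator `P` (the local formula is `P(Z̃ x) · det(N, Z̃ x, dZ̃(x) ·)`);
* `pullback_residueForm_symm` — **`Φ^* Res(PΩ/F) = (∏_k a_k) • Res(QΩ/F)` with `Q(z) = P(a • z)`**:
  in print `g^* Res(PΩ/F) = det(g) · Res((P ∘ g) Ω/F)` for a linear symmetry `g` of `F`, the residue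
  being natural and `g^*Ω = det(g) Ω` (Voisin II §6.1.3; Shioda 1979 §1 (1.7): the residue of the
  monomial numerator `x^c` is an eigenform of the diagonal group with character `(c₀ + 1, …, c_{m+1} + 1)`);
* `eval_eq_zero_of_residueForm_eq_zero`, `eq_zero_of_residueForm_eq_zero` — **if `Res(PΩ/F) = 0`
  then `P` vanishes on the cone `V(F)`, hence `P = 0`** when `F` is prime (degree count
  `deg P = d − m − 2 < d = deg F`, Hilbert's Nullstellensatz): the injectivity of
  `S^{d−m−2} → H⁰(Y, K_Y)`, `P ↦ Res(PΩ/F)` (Voisin II, Cor. 6.12 at `p = 1`: `R_F^{d−m−2} = S^{d−m−2}`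
  since the Jacobian ideal is generated in degree `d − 1`).

## References

* [VoisinHodgeII2003] C. Voisin, Hodge Theory and Complex Algebraic Geometry II (2003), §6.1.1,
  §6.1.3, Thm. 6.10, Cor. 6.12.
* [Shioda1979HodgeFermat] T. Shioda, The Hodge conjecture for Fermat varieties, Math. Ann. 245
  (1979), §1 (1.7).
* [Griffiths1969] P. Griffiths, On the periods of certain rational integrals I, Ann. of Math. 90
  (1969), §8.
-/

noncomputable section

open scoped Manifold ContDiff Topology LinearAlgebra.Projectivization
open Set Filter Projectivization

namespace Literature.AlgebraicGeometry.HodgeTheory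

open Literature.NumberTheory.Transcendental Literature.Geometry.Kaehler

section Model

variable {m : ℕ} {E : Type*} [NormedAddCommGroup E] [NormedSpace ℂ E]
  {M : Type*} [TopologicalSpace M] [ChartedSpace E M]
  {ψ : M → ℙ ℂ (Fin (m + 2) → ℂ)}

/-! ### Linearity in the numerator -/

/-- The local residue formula with numerator `P` is `P(Z̃ᵢ x)` times the formula with numerator `1`.
[cite: VoisinHodgeII2003, §6.1.3] -/
theorem residueFormula_eq_eval_smul_one (F P : MvPolynomial (Fin (m + 2)) ℂ) (i j : Fin (m + 2)) (x : M) :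
    residueFormula (E := E) ψ F P i j x =
      MvPolynomial.eval (projLift ψ i x) P • residueFormula (E := E) ψ F 1 i j x := by
  rw [residueFormula, residueFormula, map_one, one_smul]

/-- The local residue formula is additive in the numerator. [cite: VoisinHodgeII2003, §6.1.3] -/
theorem residueFormula_add (F P Q : MvPolynomial (Fin (m + 2)) ℂ) (i j : Fin (m + 2)) (x : M) :
    residueFormula (E := E) ψ F (P + Q) i j x = residueFormula ψ F P i j x + residueFormula ψ F Q i j x := by
  rw [residueFormula, residueFormula, residueFormula, map_add]
  exact add_smul (MvPolynomial.eval (projLift ψ i x) P) (MvPolynomial.eval (projLift ψ i x) Q)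
    (coneResidue (normalVec F (projLift ψ i x) j) (projLift ψ i x) (liftDeriv (E := E) ψ i x))

/-- The local residue formula is homogeneous in the numerator. [cite: VoisinHodgeII2003, §6.1.3] -/
theorem residueFormula_smul (F : MvPolynomial (Fin (m + 2)) ℂ) (c : ℂ) (P : MvPolynomial (Fin (m + 2)) ℂ)
    (i j : Fin (m + 2)) (x : M) :
    residueFormula (E := E) ψ F (c • P) i j x = c • residueFormula ψ F P i j x := by
  rw [residueFormula, residueFormula, MvPolynomial.smul_eval, mul_smul]

/-- **The residue form is additive in the numerator**: `Res((P+Q)Ω/F) = Res(PΩ/F) + Res(QΩ/F)`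
(pointwise the indices chosen in `residueForm` depend on `x` and `F` only). [cite: VoisinHodgeII2003, §6.1.3] -/
theorem residueForm_add (F P Q : MvPolynomial (Fin (m + 2)) ℂ) :
    residueForm (E := E) ψ F (P + Q) = residueForm ψ F P + residueForm ψ F Q := by
  funext x
  change (show E [⋀^Fin m]→L[ℝ] ℂ from (residueFormula ψ F (P + Q) _ _ x).restrictScalars ℝ) =
    (show E [⋀^Fin m]→L[ℝ] ℂ from (residueFormula ψ F P _ _ x).restrictScalars ℝ) +
      (show E [⋀^Fin m]→L[ℝ] ℂ from (residueFormula ψ F Q _ _ x).restrictScalars ℝ)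
  rw [residueFormula_add]
  ext v
  rfl

/-- **The residue form is homogeneous in the numerator**: `Res((c P)Ω/F) = c • Res(PΩ/F)`.
[cite: VoisinHodgeII2003, §6.1.3] -/
theorem residueForm_smul (F : MvPolynomial (Fin (m + 2)) ℂ) (c : ℂ) (P : MvPolynomial (Fin (m + 2)) ℂ) :
    residueForm (E := E) ψ F (c • P) = c • residueForm ψ F P := by
  funext x
  change (show E [⋀^Fin m]→L[ℝ] ℂ from (residueFormula ψ F (c • P) _ _ x).restrictScalars ℝ) =
    c • (show E [⋀^Fin m]→L[ℝ] ℂ from (residueFormula ψ F P _ _ x).restrictScalars ℝ)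
  rw [residueFormula_smul]
  ext v
  rfl

/-- `Res(0 · Ω/F) = 0`. [cite: VoisinHodgeII2003, §6.1.3] -/
theorem residueForm_zero (F : MvPolynomial (Fin (m + 2)) ℂ) :
    residueForm (E := E) ψ F 0 = 0 := by
  have h := residueForm_smul (E := E) (ψ := ψ) F 0 0
  rwa [zero_smul, zero_smul] at h


/-! ### The residue form under a diagonal symmetry, any degree `d ≥ m + 2` -/

variable {a : Fin (m + 2) → ℂˣ} {Φ : M → M}
  (hΦ : ∀ x, ψ (Φ x) = Projectivization.mk ℂ (a • (ψ x).rep)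
    ((smul_ne_zero_iff_ne a).mpr (Projectivization.rep_nonzero _)))

omit [TopologicalSpace M] [ChartedSpace E M] in
/-- `(a/aᵢ) · z = aᵢ⁻¹ • (a • z)` (bookkeeping for the normalised lifts). [folklore] -/
private theorem diagScale_eq_inv_smul (i : Fin (m + 2)) (z : Fin (m + 2) → ℂ) :
    (fun k ↦ ((a k : ℂ) / (a i : ℂ))) * z = ((a i : ℂ))⁻¹ • (a • z) := by
  funext k
  rw [Pi.mul_apply, Pi.smul_apply, Pi.smul_apply', Units.smul_def, smul_eq_mul, smul_eq_mul]
  ring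

include hΦ in
/-- **`Φ^* Res(PΩ/F) = (∏_k a_k) • Res(QΩ/F)`, `Q(z) = P(a • z)`, for a hypersurface of any degree
`d ≥ m + 2`.** For `F` homogeneous of degree `d` with non-vanishing gradient on its cone and
`F(a • z) = F(z)`, `ψ` continuous into `V(F)` with holomorphic affine coordinates, `Φ` holomorphic over
`[z] ↦ [a • z]`, `P` homogeneous of degree `d − m − 2` and `Q` any polynomial with `Q(z) = P(a • z)`:
`Φ^* (ψ^* Res_Y(PΩ/F)) = (∏_k a_k) • ψ^* Res_Y(QΩ/F)` on all of `M`. At `x ∈ Mᵢ` with `∂_jF(Z̃ᵢ x) ≠ 0`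
both `x` and `Φ x` are in the domain of the local formula with indices `(i, j)`
(`residueForm_eventuallyEq`), `Z̃ᵢ(Φ x) = (a/aᵢ) Z̃ᵢ x`, the numerator contributes
`P((a/aᵢ) Z̃ᵢ x) = aᵢ^{−(d−m−2)} Q(Z̃ᵢ x)` and the numerator-`1` form contributes
`aᵢ^d ∏_k (a_k/aᵢ)` (`pullback_residueFormula_one_symm_of_smul`, `normalVec_diagScale`); the exponents
of `aᵢ` cancel. In print: `g^* Res(PΩ/F) = det(g) · Res((P ∘ g)Ω/F)` — the residue map is
equivariant and `g^*Ω = det(g) Ω` (Voisin II §6.1.3); for the Fermat variety and `P = x^c` this is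
Shioda's (1.7): `Res(x^c Ω/F)` has character `(c₀ + 1, …, c_{m+1} + 1)`.
[cite: VoisinHodgeII2003, §6.1.3] [cite: Shioda1979HodgeFermat, §1 (1.7)] -/
theorem pullback_residueForm_symm {F : MvPolynomial (Fin (m + 2)) ℂ} {d : ℕ} (hF : F.IsHomogeneous d)
    (hd : m + 2 ≤ d) (hψ : Continuous ψ) (hrange : Set.range ψ ⊆ projZeroLocus {F})
    (hjac : ∀ z : Fin (m + 2) → ℂ, z ≠ 0 → MvPolynomial.eval z F = 0 →
      ∃ j, MvPolynomial.eval z (MvPolynomial.pderiv j F) ≠ 0)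
    (hhol : HasHolomorphicCoords E ψ) (hΦd : MDifferentiable 𝓘(ℂ, E) 𝓘(ℂ, E) Φ)
    (hFa : ∀ z, MvPolynomial.eval (a • z) F = MvPolynomial.eval z F)
    {P Q : MvPolynomial (Fin (m + 2)) ℂ} (hP : P.IsHomogeneous (d - (m + 2)))
    (hPQ : ∀ z, MvPolynomial.eval z Q = MvPolynomial.eval (a • z) P) :
    (residueForm (E := E) ψ F P).pullback 𝓘(ℝ, E) Φ =
      (∏ k, ((a k : ℂ))) • residueForm (E := E) ψ F Q := by
  funext x
  set i := residueIdx ψ x with hidef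
  have hx : x ∈ liftDomain ψ i := residueIdx_spec ψ x
  set z := projLift ψ i x with hz
  have hzF : MvPolynomial.eval z F = 0 := eval_projLift_eq_zero ψ hF hrange hx
  have hex : ∃ j, MvPolynomial.eval z (MvPolynomial.pderiv j F) ≠ 0 :=
    hjac z (projLift_ne_zero ψ i x) hzF
  set j := residueJdx F z with hjdef
  have hj : MvPolynomial.eval z (MvPolynomial.pderiv j F) ≠ 0 := residueJdx_spec hex
  have hai : ((a i : ℂ)) ≠ 0 := (a i).ne_zero
  have haj : ((a j : ℂ)) ≠ 0 := (a j).ne_zero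
  -- `(i, j)` is admissible at `Φ x` too
  have hΦx : Φ x ∈ liftDomain ψ i := mem_liftDomain_symm hΦ hx
  have hjΦ : MvPolynomial.eval (projLift ψ i (Φ x)) (MvPolynomial.pderiv j F) ≠ 0 := by
    rw [(projLift_symm hΦ hx).2, eval_pderiv_diagScale hF hFa i j]
    exact mul_ne_zero (pow_ne_zero _ (inv_ne_zero hai)) (mul_ne_zero (inv_ne_zero haj) hj)
  -- the numerator-`1` local formula with the frozen indices, as a form
  set ω₀ : MForm 𝓘(ℝ, E) M ℂ m := fun y ↦
    show E [⋀^Fin m]→L[ℝ] ℂ from (residueFormula (E := E) ψ F 1 i j y).restrictScalars ℝ with hω₀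
  have key := pullback_residueFormula_one_symm_of_smul hΦ hψ hhol hΦd hx
    (normalVec_diagScale hF hFa (by omega) i j (projLift ψ i x)) (ω₀ := ω₀) rfl rfl
  -- the residue form of `P` at `Φ x`, through the local formula with indices `(i, j)`
  have hωΦx := (residueForm_eventuallyEq ψ hF hψ hrange hjac hhol hP hd hΦx hjΦ).self_of_nhds
  -- the numerator at `Φ x`
  have hevP : MvPolynomial.eval (projLift ψ i (Φ x)) P =
      ((a i : ℂ))⁻¹ ^ (d - (m + 2)) * MvPolynomial.eval z Q := by
    rw [(projLift_symm hΦ hx).2, hPQ, diagScale_eq_inv_smul, eval_smul_of_isHomogeneous hP]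
  -- the scalar bookkeeping `aᵢ^{-(d-m-2)} · aᵢ^d · ∏ (a_k/aᵢ) = ∏ a_k`
  have hscal : ((a i : ℂ))⁻¹ ^ (d - (m + 2)) * ((a i : ℂ) ^ d * ∏ k, ((a k : ℂ) / (a i : ℂ))) =
      ∏ k, ((a k : ℂ)) := by
    rw [Finset.prod_div_distrib, Finset.prod_const, Finset.card_univ, Fintype.card_fin]
    obtain ⟨e, rfl⟩ : ∃ e, d = e + (m + 2) := ⟨d - (m + 2), by omega⟩
    rw [Nat.add_sub_cancel, pow_add, inv_pow]
    field_simp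
  -- evaluate both sides on `v`
  ext v
  have lhs : (residueForm (E := E) ψ F P).pullback 𝓘(ℝ, E) Φ x v =
      MvPolynomial.eval (projLift ψ i (Φ x)) P *
        ((((a i : ℂ)) ^ d * ∏ k, ((a k : ℂ) / (a i : ℂ))) * residueFormula (E := E) ψ F 1 i j x v) := by
    have h1 : (residueForm (E := E) ψ F P).pullback 𝓘(ℝ, E) Φ x v =
        MvPolynomial.eval (projLift ψ i (Φ x)) P * ω₀.pullback 𝓘(ℝ, E) Φ x v := by
      rw [MForm.pullback_apply, MForm.pullback_apply, hωΦx]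
      change (residueFormula (E := E) ψ F P i j (Φ x)) _ = _ * (residueFormula (E := E) ψ F 1 i j (Φ x)) _
      rw [residueFormula_eq_eval_smul_one, ContinuousAlternatingMap.smul_apply, smul_eq_mul]
    rw [h1, key, ContinuousAlternatingMap.smul_apply, smul_eq_mul]
    rfl
  have rhs : ((∏ k, ((a k : ℂ))) • residueForm (E := E) ψ F Q) x v =
      (∏ k, ((a k : ℂ))) * (MvPolynomial.eval z Q * residueFormula (E := E) ψ F 1 i j x v) := by
    change ((∏ k, ((a k : ℂ))) • residueForm (E := E) ψ F Q x) v = _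
    rw [ContinuousAlternatingMap.smul_apply, smul_eq_mul]
    change _ * (residueFormula (E := E) ψ F Q i j x) v = _
    rw [residueFormula_eq_eval_smul_one, ContinuousAlternatingMap.smul_apply, smul_eq_mul]
  rw [lhs, rhs, hevP, ← hscal]
  ring

/-! ### Vanishing of the residue form forces the numerator to vanish on the cone -/

/-- **If `Res(PΩ/F)` vanishes at `x` then `P(Z̃ x) = 0`**: for `ψ` an embedding into `V(F)` with
holomorphic affine coordinates, the Jacobian condition and `dim_ℂ E = m`, the numerator-`1` local
formula does not vanish at `x` (`residueFormula_one_ne_zero`), and the residue form with numerator `P`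
is `P(Z̃ᵢ x)` times it. [cite: VoisinHodgeII2003, §6.1.3 and Cor. 6.12 (p = 1)] -/
theorem eval_projLift_eq_zero_of_residueForm_apply_eq_zero [FiniteDimensional ℂ E]
    [IsManifold 𝓘(ℂ, E) ω M] {F : MvPolynomial (Fin (m + 2)) ℂ} {d : ℕ}
    (hF : F.IsHomogeneous d) (hψ : Topology.IsEmbedding ψ) (hrange : Set.range ψ ⊆ projZeroLocus {F})
    (hjac : ∀ z : Fin (m + 2) → ℂ, z ≠ 0 → MvPolynomial.eval z F = 0 →
      ∃ j, MvPolynomial.eval z (MvPolynomial.pderiv j F) ≠ 0)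
    (hhol : HasHolomorphicCoords E ψ) (hdim : Module.finrank ℂ E = m)
    (P : MvPolynomial (Fin (m + 2)) ℂ) {x : M} (h0 : residueForm (E := E) ψ F P x = 0) :
    MvPolynomial.eval (projLift ψ (residueIdx ψ x) x) P = 0 := by
  set i := residueIdx ψ x with hidef
  have hx : x ∈ liftDomain ψ i := residueIdx_spec ψ x
  set z := projLift ψ i x with hz
  have hzF : MvPolynomial.eval z F = 0 := eval_projLift_eq_zero ψ hF hrange hx
  have hex : ∃ j, MvPolynomial.eval z (MvPolynomial.pderiv j F) ≠ 0 :=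
    hjac z (projLift_ne_zero ψ i x) hzF
  have hj : MvPolynomial.eval z (MvPolynomial.pderiv (residueJdx F z) F) ≠ 0 := residueJdx_spec hex
  have hne := residueFormula_one_ne_zero ψ hF hψ hrange hjac hhol hdim hx hj
  by_contra hP
  apply hne
  ext v
  have hv := congrArg (fun B : E [⋀^Fin m]→L[ℝ] ℂ ↦ B v) h0
  change (residueFormula (E := E) ψ F P i (residueJdx F z) x) v = 0 at hv
  rw [residueFormula_eq_eval_smul_one, ContinuousAlternatingMap.smul_apply, smul_eq_mul,
    mul_eq_zero] at hv
  exact hv.resolve_left hP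

/-- **If `Res(PΩ/F) = 0` identically then `P` vanishes at every non-zero zero of `F`**, for `ψ` an
embedding ONTO `V(F)` (so that every point `[z]` of the hypersurface is some `ψ x`) and `P`
homogeneous (so that vanishing at the normalised lift `Z̃ x` of `[z]` is vanishing at `z`).
[cite: VoisinHodgeII2003, §6.1.3 and Cor. 6.12 (p = 1)] -/
theorem eval_eq_zero_of_residueForm_eq_zero [FiniteDimensional ℂ E] [IsManifold 𝓘(ℂ, E) ω M]
    {F : MvPolynomial (Fin (m + 2)) ℂ} {d : ℕ}
    (hF : F.IsHomogeneous d) (hψ : Topology.IsEmbedding ψ) (hrange : Set.range ψ = projZeroLocus {F})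
    (hjac : ∀ z : Fin (m + 2) → ℂ, z ≠ 0 → MvPolynomial.eval z F = 0 →
      ∃ j, MvPolynomial.eval z (MvPolynomial.pderiv j F) ≠ 0)
    (hhol : HasHolomorphicCoords E ψ) (hdim : Module.finrank ℂ E = m)
    {P : MvPolynomial (Fin (m + 2)) ℂ} {k : ℕ} (hP : P.IsHomogeneous k)
    (h0 : residueForm (E := E) ψ F P = 0) {z : Fin (m + 2) → ℂ} (hz : z ≠ 0)
    (hzF : MvPolynomial.eval z F = 0) : MvPolynomial.eval z P = 0 := by
  by_cases hF0 : F = 0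
  · -- then the Jacobian condition fails at `z`: vacuous
    obtain ⟨j, hj⟩ := hjac z hz hzF
    exact absurd (by rw [hF0, map_zero, map_zero]) hj
  have hS : ∀ G ∈ ({F} : Set (MvPolynomial (Fin (m + 2)) ℂ)), G.IsHomogeneous G.totalDegree := by
    rintro G rfl; rwa [hF.totalDegree hF0]
  have hmem : Projectivization.mk ℂ z hz ∈ projZeroLocus {F} :=
    (mem_projZeroLocus_mk_iff hS z hz).mpr fun G hG ↦ by rw [Set.mem_singleton_iff.mp hG]; exact hzF
  rw [← hrange] at hmem
  obtain ⟨x, hx⟩ := hmem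
  set i := residueIdx ψ x with hidef
  have hxi : x ∈ liftDomain ψ i := residueIdx_spec ψ x
  have hPi : MvPolynomial.eval (projLift ψ i x) P = 0 :=
    eval_projLift_eq_zero_of_residueForm_apply_eq_zero hF hψ hrange.le hjac hhol hdim P
      (by rw [h0]; rfl)
  -- `z = c • Z̃ᵢ x`
  have hmk := (mk_projLift ψ hxi).trans hx
  rw [Projectivization.mk_eq_mk_iff] at hmk
  obtain ⟨c, hc⟩ := hmk
  -- `hc : c • z = Z̃ᵢ x`
  have hz' : z = (c⁻¹ : ℂˣ) • projLift ψ i x := by rw [← hc, smul_smul, inv_mul_cancel, one_smul]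
  rw [hz', Units.smul_def, eval_smul_of_isHomogeneous hP, hPi, mul_zero]

/-- **Injectivity of `P ↦ Res(PΩ/F)` on `S^{d−m−2}`**: if `F` is prime of degree `d ≥ m + 2`, `ψ` an
embedding of the non-empty `M` onto `V(F)` with holomorphic coordinates and the Jacobian condition,
`dim_ℂ E = m`, and `P` homogeneous of degree `d − m − 2` with `Res(PΩ/F) = 0`, then `P = 0`:
`P` vanishes on the cone of `F` (previous lemma; at the origin too when `deg P > 0`), so
`P ∈ √(F) = (F)` by Hilbert's Nullstellensatz, and `deg P < deg F` forces `P = 0`; for `deg P = 0`,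
`P` is a constant vanishing at a point of the non-empty cone. In print: `R_F^{d−m−2} = S^{d−m−2}`
injects into `H^{m,0}(Y)` (Voisin II, Cor. 6.12 at `p = 1`; the Jacobian ideal is generated in degree
`d − 1 > d − m − 2`). [cite: VoisinHodgeII2003, §6.1.3 Thm. 6.10 and Cor. 6.12 (p = 1)] -/
theorem eq_zero_of_residueForm_eq_zero [FiniteDimensional ℂ E] [IsManifold 𝓘(ℂ, E) ω M] [Nonempty M]
    {F : MvPolynomial (Fin (m + 2)) ℂ} {d : ℕ}
    (hF : F.IsHomogeneous d) (hprime : Prime F) (hd : m + 2 ≤ d) (hψ : Topology.IsEmbedding ψ)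
    (hrange : Set.range ψ = projZeroLocus {F})
    (hjac : ∀ z : Fin (m + 2) → ℂ, z ≠ 0 → MvPolynomial.eval z F = 0 →
      ∃ j, MvPolynomial.eval z (MvPolynomial.pderiv j F) ≠ 0)
    (hhol : HasHolomorphicCoords E ψ) (hdim : Module.finrank ℂ E = m)
    {P : MvPolynomial (Fin (m + 2)) ℂ} (hP : P.IsHomogeneous (d - (m + 2)))
    (h0 : residueForm (E := E) ψ F P = 0) : P = 0 := by
  have hvan : ∀ z : Fin (m + 2) → ℂ, z ≠ 0 → MvPolynomial.eval z F = 0 → MvPolynomial.eval z P = 0 :=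
    fun z hz hzF ↦ eval_eq_zero_of_residueForm_eq_zero hF hψ hrange hjac hhol hdim hP h0 hz hzF
  -- a point of the cone
  obtain ⟨x₀⟩ := ‹Nonempty M›
  set z₀ := projLift ψ (residueIdx ψ x₀) x₀ with hz₀
  have hz₀F : MvPolynomial.eval z₀ F = 0 := eval_projLift_eq_zero ψ hF hrange.le (residueIdx_spec ψ x₀)
  have hz₀P : MvPolynomial.eval z₀ P = 0 := hvan z₀ (projLift_ne_zero ψ _ x₀) hz₀F
  by_cases hk : d - (m + 2) = 0
  · -- constant numerator
    rw [hk] at hP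
    have hC : P = MvPolynomial.C (MvPolynomial.coeff 0 P) :=
      (MvPolynomial.totalDegree_eq_zero_iff_eq_C).mp (Nat.le_zero.mp hP.totalDegree_le)
    rw [hC, MvPolynomial.eval_C] at hz₀P
    rw [hC, hz₀P, map_zero]
  · -- positive degree: Nullstellensatz
    have hmemV : P ∈ MvPolynomial.vanishingIdeal ℂ
        (MvPolynomial.zeroLocus ℂ (Ideal.span {F})) := by
      rw [MvPolynomial.mem_vanishingIdeal_iff]
      intro z hz
      rw [MvPolynomial.mem_zeroLocus_iff] at hz
      change MvPolynomial.eval z P = 0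
      have hzF : MvPolynomial.eval z F = 0 := hz F (Ideal.subset_span rfl)
      by_cases hz0 : z = 0
      · have h := eval_smul_of_isHomogeneous hP (0 : ℂ) z
        rwa [zero_smul, zero_pow hk, zero_mul, ← hz0] at h
      · exact hvan z hz0 hzF
    rw [MvPolynomial.vanishingIdeal_zeroLocus_eq_radical,
      ((Ideal.span_singleton_prime hprime.ne_zero).mpr hprime).radical, Ideal.mem_span_singleton] at hmemV
    by_contra hP0
    obtain ⟨G, hG⟩ := hmemV
    have hG0 : G ≠ 0 := by rintro rfl; exact hP0 (by rw [hG, mul_zero])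
    have hdeg := MvPolynomial.totalDegree_mul_of_isDomain hprime.ne_zero hG0
    rw [← hG, hF.totalDegree hprime.ne_zero] at hdeg
    have hle : P.totalDegree ≤ d - (m + 2) := hP.totalDegree_le
    omega

end Model

end Literature.AlgebraicGeometry.HodgeTheory

end
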